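import Summits.QuantumFields.YangMills.Theses.ParabolicTrajectory
import Literature.MathematicalPhysics.QuantumFieldTheory.LatticeGaugeProofs
import Literature.Probability.LatticeModels.ProductMeasureTools

/-!
# `TunedSequenceExists` — negative lemma: no witness at `β = 0`
# (the clause `β_k → ∞` is load-bearing from below)

Crux `Summit.QuantumFields.YangMills.Theses.ParabolicTrajectory.TunedSequenceExists` (item
stmt-QuantumFields-10524; cdisprove gen 2, importable extract of the crux workfile
`Summits/QuantumFields/YangMills/Cruxes/TunedSequenceExists/Disproof.lean`):

* `wilsonMeasure_zero` — at `β = 0` the torus Wilson measure is product Haar measure;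
* `latticeConnectedCorr_zero_of_disjoint` — cylinder observables with torus-disjoint supports are
  uncorrelated at `β = 0` (independence over disjoint edge sets + translation invariance);
* `latticeConnectedCorr_curvature_zero` — the curvature correlator `⟨P ; τ_m P⟩_{0, S}` vanishes
  EXACTLY for `2 ≤ m ≤ S - 2` (the lower endpoint `N_1(k, 0) = 0` of the tuning-by-IVT argument);
* `window_atZero_false`, `tunedSequenceExists_atZero_false` — the variant of the crux with
  `β_k → ∞` replaced by `β_k = 0` is false for every `G`, `r`, `M ≥ 2`.
-/

noncomputable section

open Filter Topology MeasureTheory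
open Literature.MathematicalPhysics.QuantumFieldTheory Literature.MathematicalPhysics.QuantumLattice

namespace Summit.QuantumFields.YangMills.Theorems.TunedSequenceExists.Negative.AtZeroFalse

section Scheme

variable {ι : Type}

/-- Shape clause + `a_k → 0` force `M^{n_k} → ∞`. -/
theorem tendsto_pow_of_shape {M : ℕ} (sch : SpeciesScheme ι) {n : ℕ → ℕ}
    (hshape : ∀ k, sch.a k = ((M : ℝ) ^ n k)⁻¹) :
    Tendsto (fun k => (M : ℝ) ^ n k) atTop atTop := by
  have hinv : ∀ k, (M : ℝ) ^ n k = (sch.a k)⁻¹ := fun k => by rw [hshape k, inv_inv]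
  simp only [hinv]
  exact (tendsto_inv_nhdsGT_zero.comp
    (tendsto_nhdsWithin_iff.2 ⟨sch.tendsto_a, Eventually.of_forall fun k => sch.a_pos k⟩))

/-- Shape clause + `a_k → 0` force `n_k → ∞` (for `M ≥ 2`). -/
theorem tendsto_exponent_of_shape {M : ℕ} (hM : 2 ≤ M) (sch : SpeciesScheme ι)
    {n : ℕ → ℕ} (hshape : ∀ k, sch.a k = ((M : ℝ) ^ n k)⁻¹) :
    Tendsto n atTop atTop := by
  have hpow := tendsto_pow_of_shape sch hshape
  refine tendsto_atTop.2 fun m => ?_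
  have hM1 : (1 : ℝ) < M := by exact_mod_cast hM
  filter_upwards [tendsto_atTop.1 hpow ((M : ℝ) ^ m)] with k hk
  exact (pow_le_pow_iff_right₀ hM1).1 hk

/-- No wrap-around: the separations `t · M^{n_k}` eventually fit in the half-torus `L_k`
(from `a_k L_k → ∞`). -/
theorem eventually_sep_le_L {M : ℕ} (sch : SpeciesScheme ι) {n : ℕ → ℕ}
    (hshape : ∀ k, sch.a k = ((M : ℝ) ^ n k)⁻¹) (t : ℕ) :
    ∀ᶠ k in atTop, t * M ^ n k ≤ sch.L k := by
  filter_upwards [tendsto_atTop.1 sch.tendsto_L (t : ℝ)] with k hk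
  have ha : 0 < sch.a k := sch.a_pos k
  have hpow : (M : ℝ) ^ n k = (sch.a k)⁻¹ := by rw [hshape k, inv_inv]
  have h : (t : ℝ) * (M : ℝ) ^ n k ≤ sch.L k := by
    rw [hpow, ← div_eq_mul_inv, div_le_iff₀ ha, mul_comm]
    exact hk
  exact_mod_cast h

/-- If the shape clause holds with `M^{n_k} = 1` for all `k`, the scheme axioms are violated. -/
theorem false_of_a_eq_one (sch : SpeciesScheme ι) (h : ∀ k, sch.a k = 1) : False := by
  have h1 : Tendsto (fun _ : ℕ => (1 : ℝ)) atTop (𝓝 0) := by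
    have hfun : sch.a = fun _ => 1 := funext h
    exact hfun ▸ sch.tendsto_a
  have := tendsto_nhds_unique h1 tendsto_const_nhds
  norm_num at this

end Scheme

section BetaZero

variable {G : Type} [Group G] [TopologicalSpace G] [IsTopologicalGroup G] [CompactSpace G]
  [MeasurableSpace G] [BorelSpace G] {N : ℕ}

omit [Group G] [IsTopologicalGroup G] [CompactSpace G] in
/-- Normalised Haar measure is a probability measure. -/
theorem isProbabilityMeasure_haarProbability [Group G] [IsTopologicalGroup G] [CompactSpace G] :
    IsProbabilityMeasure (haarProbability G) := by
  refine ⟨?_⟩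
  show Measure.haarMeasure ⊤ Set.univ = 1
  rw [← TopologicalSpace.PositiveCompacts.coe_top]
  exact Measure.haarMeasure_self

/-- **At `β = 0` the Wilson measure is product Haar measure.** -/
theorem wilsonMeasure_zero {S : ℕ} [NeZero S] (ρ : G →* Matrix (Fin N) (Fin N) ℂ) :
    wilsonMeasure (d := 4) (L := S) ρ 0 = Measure.pi fun _ : Edge 4 S => haarProbability G := by
  haveI := isProbabilityMeasure_haarProbability (G := G)
  have hw : wilsonWeight (d := 4) (L := S) ρ 0 = Measure.pi fun _ : Edge 4 S => haarProbability G := by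
    have h1 : (fun U : GaugeConfig 4 S G => ENNReal.ofReal (Real.exp (-0 * wilsonAction ρ U))) = 1 := by
      funext U; simp
    rw [wilsonWeight, h1, withDensity_one]
  have hZ : partitionFunction (d := 4) (L := S) ρ 0 = 1 := by
    rw [partitionFunction, hw, measure_univ]
  rw [wilsonMeasure, hZ, inv_one, one_smul, hw]

omit [Group G] [TopologicalSpace G] [IsTopologicalGroup G] [CompactSpace G] [MeasurableSpace G]
  [BorelSpace G] in
/-- A cylinder observable read on the periodic lift depends only on the image torus edges. -/
theorem dependsOn_comp_torusLift {S : ℕ} {A : LGConfig 4 G → ℝ}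
    {s : Finset (Literature.MathematicalPhysics.QuantumLattice.ZdEdge 4)} (hA : IsCylinder A s) :
    DependsOn (fun U : GaugeConfig 4 S G => A (torusLift S U)) ↑(s.image (torusEdge S)) := by
  intro U V h
  refine hA fun e he => ?_
  simp only [torusLift, Function.comp_apply]
  exact h (torusEdge S e) (Finset.mem_coe.2 (Finset.mem_image_of_mem _ (Finset.mem_coe.1 he)))

/-- **At `β = 0`, observables with torus-disjoint supports are uncorrelated** (product Haar
measure: independence over disjoint edge sets, plus translation invariance for the subtracted
term). -/
theorem latticeConnectedCorr_zero_of_disjoint [SecondCountableTopology G] {S : ℕ} [NeZero S]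
    (ρ : G →* Matrix (Fin N) (Fin N) ℂ) {A B : LGConfig 4 G → ℝ} {sA sB : Finset (Literature.MathematicalPhysics.QuantumLattice.ZdEdge 4)}
    (hA : IsCylinder A sA) (hB : IsCylinder B sB) (hAm : Measurable A) (hBm : Measurable B)
    (m : ℕ)
    (hdisj : Disjoint (sA.image (torusEdge S))
      ((sB.image fun e => (e.1 - (-Pi.single 0 (m : ℤ)), e.2)).image (torusEdge S))) :
    latticeConnectedCorr ρ 0 S A B m = 0 := by
  classical
  haveI := isProbabilityMeasure_haarProbability (G := G)
  -- translation invariance of the subtracted term (at any β; here β = 0)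
  have hshift : ∫ U, B (configShift (-Pi.single 0 (m : ℤ)) (torusLift S U))
      ∂(wilsonMeasure (d := 4) (L := S) ρ 0) = ∫ U, B (torusLift S U) ∂(wilsonMeasure ρ 0) := by
    have h := wilsonExpectation_comp_torusConfigShift (d := 4) (L := S) ρ 0
      (Literature.Probability.LatticeModels.Torus.proj S (-Pi.single 0 (m : ℤ)))
      (toTorusObservable S B)
    rw [← toTorusObservable_comp_configShift] at h
    simpa [wilsonExpectation, toTorusObservable] using h
  -- independence of the two factors under product Haar measure
  have hfac : ∫ U, A (torusLift S U) * B (configShift (-Pi.single 0 (m : ℤ)) (torusLift S U))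
      ∂(wilsonMeasure (d := 4) (L := S) ρ 0) =
      (∫ U, A (torusLift S U) ∂(wilsonMeasure (d := 4) (L := S) ρ 0)) *
        ∫ U, B (configShift (-Pi.single 0 (m : ℤ)) (torusLift S U))
          ∂(wilsonMeasure (d := 4) (L := S) ρ 0) := by
    rw [wilsonMeasure_zero, ← Measure.infinitePi_eq_pi]
    refine Literature.Probability.LatticeModels.integral_mul_eq_of_dependsOn_disjoint
      (fun _ : Edge 4 S => haarProbability G) hdisj ?_ ?_ ?_ ?_
    · exact hAm.comp (measurable_torusLift S)
    · exact (hBm.comp (configShift _).measurable).comp (measurable_torusLift S)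
    · exact dependsOn_comp_torusLift hA
    · simpa [Function.comp_def] using
        dependsOn_comp_torusLift (S := S) (IsCylinder.comp_configShift hB (-Pi.single 0 (m : ℤ)))
  unfold latticeConnectedCorr
  rw [hfac, hshift, sub_self]

omit [TopologicalSpace G] [IsTopologicalGroup G] [CompactSpace G] [BorelSpace G] in
/-- Edges in the support of the curvature species have time coordinate `0` or `1`. -/
theorem time_coord_of_mem_curvature_supp [TopologicalSpace G] [IsTopologicalGroup G]
    [CompactSpace G] [BorelSpace G] (r : LatticeRep G) {e : Literature.MathematicalPhysics.QuantumLattice.ZdEdge 4}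
    (he : e ∈ r.curvature.supp) : e.1 0 = 0 ∨ e.1 0 = 1 := by
  have hsupp : r.curvature.supp =
      Finset.univ.biUnion fun p : Fin 4 × Fin 4 => originPlaquetteSupport p.1 p.2 := rfl
  rw [hsupp, Finset.mem_biUnion] at he
  obtain ⟨p, -, hp⟩ := he
  simp only [originPlaquetteSupport, Finset.mem_insert, Finset.mem_singleton] at hp
  rcases hp with rfl | rfl | rfl | rfl
  · left; rfl
  · simp [Pi.single_apply]
    by_cases h : (0 : Fin 4) = p.1 <;> simp [h]
  · simp [Pi.single_apply]
    by_cases h : (0 : Fin 4) = p.2 <;> simp [h]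
  · left; rfl

/-- The curvature supports at the origin and at `m e₀` are torus-disjoint when `2 ≤ m` and
`m + 2 ≤ S`. -/
theorem disjoint_curvature_supp (r : LatticeRep G) {S m : ℕ} (hm : 2 ≤ m) (hmS : m + 2 ≤ S) :
    Disjoint (r.curvature.supp.image (torusEdge S))
      ((r.curvature.supp.image fun e => (e.1 - (-Pi.single 0 (m : ℤ)), e.2)).image
        (torusEdge S)) := by
  classical
  rw [Finset.disjoint_left]
  rintro f hf hf'
  obtain ⟨e, he, rfl⟩ := Finset.mem_image.1 hf
  obtain ⟨g, hg, hfg⟩ := Finset.mem_image.1 hf'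
  obtain ⟨e', he', rfl⟩ := Finset.mem_image.1 hg
  -- compare time coordinates modulo S
  have h0 : (Literature.Probability.LatticeModels.Torus.proj S (e'.1 - -Pi.single 0 (m : ℤ))) 0 =
      (Literature.Probability.LatticeModels.Torus.proj S e.1) 0 := by
    have := congrArg (fun x : Edge 4 S => x.1 0) hfg
    simpa [torusEdge] using this
  simp only [Literature.Probability.LatticeModels.Torus.proj_apply, sub_neg_eq_add, Pi.add_apply,
    Pi.single_eq_same] at h0
  push_cast at h0
  have hdvd : (S : ℤ) ∣ (e'.1 0 + m - e.1 0) := by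
    have h1 : ((e'.1 0 + m - e.1 0 : ℤ) : ZMod S) = 0 := by
      push_cast
      rw [← h0]; ring
    exact (ZMod.intCast_zmod_eq_zero_iff_dvd _ S).1 h1
  have hpos : 0 < e'.1 0 + m - e.1 0 := by
    rcases time_coord_of_mem_curvature_supp r he with h | h <;>
      rcases time_coord_of_mem_curvature_supp r he' with h' | h' <;> omega
  have hlt : e'.1 0 + m - e.1 0 < S := by
    rcases time_coord_of_mem_curvature_supp r he with h | h <;>
      rcases time_coord_of_mem_curvature_supp r he' with h' | h' <;> omega
  have := Int.le_of_dvd hpos hdvd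
  omega

/-- **At `β = 0` the curvature correlator vanishes exactly** for separations `2 ≤ m ≤ S - 2`
(independent Haar links; the IVT lower endpoint `N_1(k, 0) = 0`). -/
theorem latticeConnectedCorr_curvature_zero (r : LatticeRep G) {S m : ℕ} [NeZero S]
    (hm : 2 ≤ m) (hmS : m + 2 ≤ S) :
    latticeConnectedCorr r.ρ 0 S r.curvature.F r.curvature.F m = 0 := by
  haveI : SecondCountableTopology G :=
    (r.continuous.isClosedEmbedding r.injective).isEmbedding.secondCountableTopology
  exact latticeConnectedCorr_zero_of_disjoint r.ρ r.curvature.isCylinder r.curvature.isCylinder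
    r.curvature.measurable r.curvature.measurable m (disjoint_curvature_supp r hm hmS)


/-- **No witness at infinite bare coupling**: for every `G`, `r`, `M ≥ 2` the `β = 0` variant of
the crux body (clause (iii) dropped) is false — `N_1(k) = 0` eventually. -/
theorem window_atZero_false (r : LatticeRep G) {M : ℕ} (hM : 2 ≤ M) :
    ¬ (∃ θ₀ : ℝ, 0 < θ₀ ∧ ∀ θ : ℝ, 0 < θ → θ < θ₀ →
        ∃ (sch : SpeciesScheme (YMSpecies G)) (n : ℕ → ℕ),
          (∀ k, sch.a k = ((M : ℝ) ^ n k)⁻¹) ∧ (∀ k, sch.β k = 0) ∧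
          Tendsto (fun k => ((M : ℝ) ^ n k) ^ 8 *
              latticeConnectedCorr r.ρ (sch.β k) (sch.side k) r.curvature.F r.curvature.F
                (M ^ n k)) atTop (𝓝 θ)) := by
  rintro ⟨θ₀, hθ₀, h⟩
  obtain ⟨sch, n, hshape, hβ0, hlim⟩ := h (θ₀ / 2) (by positivity) (by linarith)
  have hev : ∀ᶠ k in atTop, ((M : ℝ) ^ n k) ^ 8 *
      latticeConnectedCorr r.ρ (sch.β k) (sch.side k) r.curvature.F r.curvature.F (M ^ n k) =
        0 := by
    filter_upwards [eventually_sep_le_L sch hshape 1,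
      (tendsto_exponent_of_shape hM sch hshape).eventually_ge_atTop 1] with k hk1 hk2
    have h2 : 2 ≤ M ^ n k :=
      calc 2 ≤ M := hM
        _ = M ^ 1 := (pow_one M).symm
        _ ≤ M ^ n k := Nat.pow_le_pow_right (by omega) hk2
    have hside : sch.side k = 2 * sch.L k + 1 := rfl
    have hmS : M ^ n k + 2 ≤ sch.side k := by rw [hside]; omega
    rw [hβ0 k, latticeConnectedCorr_curvature_zero r h2 hmS, mul_zero]
  have h0 : Tendsto (fun k => ((M : ℝ) ^ n k) ^ 8 *
      latticeConnectedCorr r.ρ (sch.β k) (sch.side k) r.curvature.F r.curvature.F (M ^ n k))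
      atTop (𝓝 0) :=
    tendsto_const_nhds.congr' (hev.mono fun k hk => hk.symm)
  have := tendsto_nhds_unique hlim h0
  linarith

end BetaZero

/-- **`TunedSequenceExists` with `β_k → ∞` replaced by `β_k = 0` is false**, relative to any
inhabitant of `IsCompactSimpleLieGroup` (e.g. `SU(2)` via the tree's named fact). -/
theorem tunedSequenceExists_atZero_false {H : Type} [Group H] [TopologicalSpace H]
    [IsTopologicalGroup H] [CompactSpace H] (hH : IsCompactSimpleLieGroup H) :
    ¬ (∀ (G : Type) [Group G] [TopologicalSpace G] [IsTopologicalGroup G] [CompactSpace G],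
        IsCompactSimpleLieGroup G → letI : MeasurableSpace G := borel G
        haveI : BorelSpace G := ⟨rfl⟩
        ∀ (r : LatticeRep G) (M : ℕ), 2 ≤ M → ∃ θ₀ : ℝ, 0 < θ₀ ∧ ∀ θ : ℝ, 0 < θ → θ < θ₀ →
          ∃ (sch : SpeciesScheme (YMSpecies G)) (n : ℕ → ℕ),
            (∀ k, sch.a k = ((M : ℝ) ^ n k)⁻¹) ∧ (∀ k, sch.β k = 0) ∧
            Tendsto (fun k => ((M : ℝ) ^ n k) ^ 8 *
                latticeConnectedCorr r.ρ (sch.β k) (sch.side k) r.curvature.F r.curvature.F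
                  (M ^ n k)) atTop (𝓝 θ)) := by
  intro h
  obtain ⟨r⟩ := hH.2
  letI : MeasurableSpace H := borel H
  haveI : BorelSpace H := ⟨rfl⟩
  exact window_atZero_false r le_rfl (h H hH r 2 le_rfl)

end Summit.QuantumFields.YangMills.Theorems.TunedSequenceExists.Negative.AtZeroFalse

end
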